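import Literature.AlgebraicGeometry.AbelianSchemes.AbelianSchemeQuotientPoincareStabilizerOfMap   -- ★ `mem_poincareStabilizerSubgroup_of_pow_eq_one_of_forall_fibre`
import HarnessLib

/-!
# `λ_*K₂ ≤ Stab(𝒩₁)` for ANY `n`-torsion subgroup `K₂` of sections whose `λ`-images die fibrewise — the NON-LAGRANGIAN dual kernel
# ([MumfordAV1970] §15 Thm. 1 «the dual of `X/K` is `X̂/K^⊥`», §23; [MilneAV2008] I §8–§9)

Topic `AlgebraicGeometry/AbelianSchemes`, namespace `Literature.AlgebraicGeometry.AbelianSchemes.AbelianSchemeOver`.  THEOREMS ONLY (no definition, no named fact,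
no instance, no notation, no `sorry`).  Cell `hodgecm-mathlib` (D-0151), F0∕P6 «MOD» line L3 (socket `stub_FROB`, road ROOF → `stub_ROOF0`, LA3-plan (g0) RULING «DUAL-B̄» #2
(C)(ii), head (H2) of LA6-p03 (g0)'s census): the quotient-dual ENGINE (★ `dualPairOfQuotientRigidified` + ★ `universal_poincareQuotRigid_of_level`) takes the dual kernel `K′ ≤ Â(S)`
through the ONE hypothesis `hK′ : K′ ≤ poincareStabilizerSubgroup` (★ `poincareStabilizerStructure hK′`), and the tree supplies it only for the LAGRANGIAN choice `K′ := λ_*K`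
(★ `map_le_poincareStabilizerSubgroup`).  For `K = A[𝔟]` (an `𝒪_F`-ideal torsion subgroup, NOT Lagrangian once `[F:ℚ] > 2`) the honest dual kernel is the ANNIHILATOR
`K′ := λ_*K₂`, `K₂ := A[n𝔟̄⁻¹]`; this file is ★ `map_le_poincareStabilizerSubgroup` with `K₂` in place of `K`: its proof is PER ELEMENT (★
`mem_poincareStabilizerSubgroup_of_pow_eq_one_of_forall_fibre`) and reads `σ` only through «`σ^n = 1`» and the fibrewise clause — so any `n`-torsion `K₂` with the fibrewise
triviality (isotropy of `K₂` against `K`, head (H3)) qualifies.  `--supports stmt-HodgeConjecture-24832`, count-neutral.  HONEST LABEL: HC_CM is proved only modulo the cell's 2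
remaining named inputs (hLiu418 24832, h413 24833) until rung 0 closes; this file discharges none of them.

* **`map_le_poincareStabilizerSubgroup_of_subgroup (K₂) (hK₂ : ∀ σ : K₂, σ ^ n = 1) (hiso₂)`** — `K₂.map (monoidHom λ) ≤ poincareStabilizerSubgroup`;
* `le_poincareStabilizerSubgroup_of_le_map (K′) (hK′ : K′ ≤ K₂.map (monoidHom λ)) …` — the same for any sub-image.

## References
* [MumfordAV1970] D. Mumford, *Abelian Varieties* (1970), §15 Thm. 1 (p. 143), §23 (p. 231).
* [MilneAV2008] J. S. Milne, *Abelian Varieties* (2008), I §8 (pp. 36–37), I §9 Thm. 9.1 (p. 42).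
-/

set_option autoImplicit false

noncomputable section

-- `(A.X ⊗ T′).left = pullback A.X.hom T′.hom = (A.baseChange T′.hom).left` hold by `rfl` only (as in ★ `…PoincareStabilizerOfMap`).
set_option backward.isDefEq.respectTransparency false

universe u

open CategoryTheory CategoryTheory.Limits AlgebraicGeometry MonoidalCategory CartesianMonoidalCategory
open scoped MonObj

namespace Literature.AlgebraicGeometry.AbelianSchemes.AbelianSchemeOver

open Literature.AlgebraicGeometry.RelativeSpec Literature.AlgebraicGeometry.Modules Literature.AlgebraicGeometry.Motives
  Literature.AlgebraicGeometry.AbelianVarieties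

variable {S : Scheme.{u}} (A : AbelianSchemeOver S)
  {Y : Scheme.{u}} (u : S ⟶ Y) (K : Subgroup A.Sections) [IsCommMonObj A.X] {n : ℕ}
  (hK : ∀ σ : K, (σ : A.Sections) ^ n = 1)
  [Finite K] [Y.IsSeparated] [IsSeparated (A.X.hom ≫ u)] [S.IsSeparated]
  (hcov : ∀ x : A.left, ∃ O : (A.translationActionOver u K).StableAffineOpens, x ∈ O.1)
  [LocallyOfFiniteType (A.X.hom ≫ u)] [IsLocallyNoetherian Y]
  (hG : ∃ _ : GrpObj (A.quotientOver u K), IsMonHom (A.quotientMk u K hcov))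
  (hsm : Smooth (A.quotientOver u K).hom) (hgc : GeometricallyConnected (A.quotientOver u K).hom)
  (D : A.DualPair) [IsAffine Y]
  (hfree : ∀ (Ω : Type u) [Field Ω] [IsAlgClosed Ω] (x : Spec (.of Ω) ⟶ A.left) (σ : K), σ ≠ 1 →
    x ≫ (A.translation (σ : A.Sections)).left ≠ x)

include hfree in
/-- **`λ_* K₂ ≤ Stab(𝒩₁)` FOR ANY `n`-TORSION SUBGROUP `K₂` OF SECTIONS WHOSE `λ`-IMAGES DIE FIBREWISE** (the non-Lagrangian dual kernel: ★ `map_le_poincareStabilizerSubgroup`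
with `K₂` in place of `K` — per element by ★ `mem_poincareStabilizerSubgroup_of_pow_eq_one_of_forall_fibre`; the fibrewise clause `hiso₂` is head (H3), the isotropy of `K₂`
against `K`). [cite: MumfordAV1970, §15 Thm. 1 (p. 143)] [cite: MilneAV2008, I §9 Thm. 9.1 (p. 42)] -/
theorem map_le_poincareStabilizerSubgroup_of_subgroup [IsReduced S] [IsLocallyNoetherian S]
    (hD : Nonempty ((Scheme.Modules.pullback (DualPair.unitHatSlice D)).obj D.P ≅ SheafOfModules.unit _))
    (lam : A.X ⟶ D.hat.X) [IsMonHom lam] (K₂ : Subgroup A.Sections) (hK₂ : ∀ σ : K₂, (σ : A.Sections) ^ n = 1)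
    (hiso₂ : ∀ (σ : K₂) ⦃Ω : Type u⦄ [Field Ω] [IsAlgClosed Ω] (s : Spec (.of Ω) ⟶ S),
      Nonempty ((Scheme.Modules.pullback ((A.quotientBy u K hcov hG hsm hgc).baseChangeToProd D.hat s
          (D.hat.restrict s ((σ : A.Sections) ≫ lam)).left (Over.w _))).obj
        ((Scheme.Modules.pullback ((A.mulNDesc u K hK hcov : (A.quotientBy u K hcov hG hsm hgc).X ⟶ A.X) ▷ D.hat.X).left).obj
          D.P) ≅ SheafOfModules.unit _)) :
    K₂.map (IsMonHom.monoidHom lam (𝟙_ (Over S))) ≤ A.poincareStabilizerSubgroup u K hK hcov hG hsm hgc D hfree := by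
  rintro k ⟨σ, hσ, rfl⟩
  have hkn : (IsMonHom.monoidHom lam (𝟙_ (Over S))) σ ^ n = 1 := by
    rw [← map_pow, hK₂ ⟨σ, hσ⟩, map_one]
  exact A.mem_poincareStabilizerSubgroup_of_pow_eq_one_of_forall_fibre u K hK hcov hG hsm hgc D hfree hD _ hkn
    (hiso₂ ⟨σ, hσ⟩)

include hfree in
/-- The same for any subgroup `K′ ≤ λ_* K₂` (stabiliser subgroups are subgroups). [cite: MumfordAV1970, §15 Thm. 1 (p. 143)] -/
theorem le_poincareStabilizerSubgroup_of_le_map [IsReduced S] [IsLocallyNoetherian S]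
    (hD : Nonempty ((Scheme.Modules.pullback (DualPair.unitHatSlice D)).obj D.P ≅ SheafOfModules.unit _))
    (lam : A.X ⟶ D.hat.X) [IsMonHom lam] (K₂ : Subgroup A.Sections) (hK₂ : ∀ σ : K₂, (σ : A.Sections) ^ n = 1)
    (hiso₂ : ∀ (σ : K₂) ⦃Ω : Type u⦄ [Field Ω] [IsAlgClosed Ω] (s : Spec (.of Ω) ⟶ S),
      Nonempty ((Scheme.Modules.pullback ((A.quotientBy u K hcov hG hsm hgc).baseChangeToProd D.hat s
          (D.hat.restrict s ((σ : A.Sections) ≫ lam)).left (Over.w _))).obj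
        ((Scheme.Modules.pullback ((A.mulNDesc u K hK hcov : (A.quotientBy u K hcov hG hsm hgc).X ⟶ A.X) ▷ D.hat.X).left).obj
          D.P) ≅ SheafOfModules.unit _))
    (K' : Subgroup D.hat.Sections) (hK' : K' ≤ K₂.map (IsMonHom.monoidHom lam (𝟙_ (Over S)))) :
    K' ≤ A.poincareStabilizerSubgroup u K hK hcov hG hsm hgc D hfree :=
  hK'.trans (A.map_le_poincareStabilizerSubgroup_of_subgroup u K hK hcov hG hsm hgc D hfree hD lam K₂ hK₂ hiso₂)

end Literature.AlgebraicGeometry.AbelianSchemes.AbelianSchemeOver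

end
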